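import Summits.BirchSwinnertonDyer.BirchSwinnertonDyer.Theses.ErratumRoadFive
import Summits.BirchSwinnertonDyer.BirchSwinnertonDyer.Theorems.ErratumRoadFiveRamNoErratumDataKolyvagin
import Summits.BirchSwinnertonDyer.BirchSwinnertonDyer.Theorems.ErratumRoadFiveRest3BranchesDefs
import HarnessLib

/-!
# Route `ErratumRoadFive` (rung K2, `p ≥ 5`), crux `RamNoErratumDataAtFive` (item stmt-BirchSwinnertonDyer-19624,
# REST‴): the registered stub `stub_rest3_locus` (REST‴ ON THE LOCUS `p ∤ ∏ c_ℓ`) is CONDITIONAL-CLOSED on the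
# Kolyvagin hypothesis `hZα` (Skinner–Zhang Thm. 1.3 shape, PREPRINT) — and the nesting of the two cuts of REST‴

Cell `bsd-stepL` (run/shared/lean/pub/bsd-stepL/), seat `bsd-stepL-rest-p2` (prover g0, 2026-08-26), planner g25's
REVISED first-act ① (a) (STATUS 13:02:47Z); `--supports stmt-BirchSwinnertonDyer-19624 --as helper`. The registered
BC3 birth skeleton of the crux (HOME/plan/D4/skel/Lines-birth-19624.lean, `ledger skeleton check` OK 13:02Z) cuts
REST‴ along the Tamagawa product: `stub_rest3_locus` (REST‴ ∧ `p ∤ ∏ c_ℓ`; class-wide 680 724 pairs, `N < 5·10⁵`,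
`p ≥ 5`) and `stub_rest3_tam` (REST⁗ = REST‴ ∧ `p ∣ ∏ c_ℓ`; 22 480 pairs); seat rest-p2's landed Defs module
(p446621) cuts it along the local torsion: `Rest3TorsionBranchAtFive` ((T), 3 687 pairs) and
`Rest3NoWitnessBranchAtFive` ((NW), 699 517 pairs).

What this file proves (THEOREMS ONLY; no definition, no named fact, no `sorry`):
* §1 **`rest3Locus_of_kolyvaginSharpAlpha`** — the statement of `stub_rest3_locus` VERBATIM from the published named
  facts, Shimura reciprocity at conductor 1 (`hrec`), McCallum's structure theorem (`hMc`), Darmon Thm. 3.6 (`h36`),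
  the JSW17 Thm. 3.3.1-mult control fact (`h331`) and **`hZα`** = Kolyvagin's non-vanishing mod `p` in the ∀-frame ♯
  typing at `p ≥ 5`, asked ONLY on the (α) ∩ Locus pairs at Hoffstein–Luo fields (imc-p1 g5's binder, VERBATIM) —
  via imc-p1 g5's pair-level kernel `Koly.openInputOnTreeAt_of_kolyvaginFramesHLAt_of_five_le` (p445195): on
  `p ∤ ∏ c_ℓ` the erratum clause (iv) is automatic (`LocalTorsion.localTorsion_eq_zero_of_not_dvd_tamagawaProduct`), so
  a REST‴ pair there is an (α) pair. By-name form over the route's support items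
  `rest3Locus_of_publishedInputsFive_of_kolyvaginSharpAlpha` (`PublishedInputsFive` 19066,
  `JSWAnticyclotomicControlMult` 19626), and the Locus-wide variant `rest3Locus_of_publishedInputsFive_of_kolyvaginFramesHL`
  from `hZ₅` (KOLY's crux shape at `p ≥ 5`).
* §2 **the nesting of the two cuts, kernel-checked**: `stub_rest3_locus` ⟸ (NW) (`rest3Locus_of_rest3NoWitnessBranchAtFive`:
  on the Locus a REST‴ pair is torsion-free at `p`, hence an (NW) pair) and (T) ⟸ `stub_rest3_tam`
  (`rest3TorsionBranchAtFive_of_rest3Tam`: a (T) pair has `p ∣ ∏ c_ℓ`), both through the crux's own binders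
  `ClassX11b ∧ 5 ≤ p` (`p2OpenInputOnTreeAt_of_imp_surj`); and `stub_rest3_tam` ⟸ (T) + (NW)
  (`rest3Tam_of_branches`), `stub_rest3_locus` ⟸ REST‴ (`rest3Locus_of_ramNoErratumDataAtFive`). So the 2×2
  refinement Locus∕Tam × (T)∕(NW) has exactly three non-empty cells: Locus∩(NW) 680 724 (= `stub_rest3_locus`,
  conditional-closed here), Tam∩(NW) 18 793 and Tam∩(T) = (T) 3 687 (= `stub_rest3_tam`, no road).

HONEST FRAMING: CONDITIONAL on every displayed binder; `hZα` ∕ `hZ₅` are conjecture-shaped hypotheses whose only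
derivation in print is Skinner–Zhang arXiv:1407.1099 Thm. 1.3 (PREPRINT, unrefereed) on its ♠-locus; nothing is
booked; the stub stays OPEN unconditionally; BSD is proved for no pair; no census word moves (T7).

References: [SkinnerZhang2014] Thm. 1.3 (arXiv:1407.1099 §1; shape of `hZα`); [McCallumLMS1991] §5 Cor. 5.6
(p. 310); [Darmon2004] Thm. 3.6; [JetchevSkinnerWan2017] Thm. 3.3.1, §7.4.1; [Kolyvagin1990] Thm. A;
[Castella2018Erratum] Thm. 1.1 (iii)–(iv); [SilvermanATAEC1994] Cor. IV.9.2(d).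
-/

set_option autoImplicit false
-- the Theorems namespace of this sub repeats the summit name by design (D-0017 nested layout)
set_option linter.dupNamespace false

noncomputable section

open scoped Classical

open WeierstrassCurve Literature.NumberTheory.EllipticCurves
  Literature.NumberTheory.EllipticCurves.ModularForms
  Literature.NumberTheory.EllipticCurves.Rank1Residual
  Summit.BirchSwinnertonDyer.Rank1Residual Summit.BirchSwinnertonDyer.Rank1Residual.X11b
  Summit.BirchSwinnertonDyer.BirchSwinnertonDyer.Theses.ErratumRoadFive

namespace Summit.BirchSwinnertonDyer.BirchSwinnertonDyer.Theorems

/-! ## §1 `stub_rest3_locus` from the Kolyvagin hypothesis `hZα` -/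

/-- **`stub_rest3_locus` (REST‴ ON THE LOCUS, registered signature VERBATIM) ⟸ the Kolyvagin road at `p ≥ 5`,
kernel form.** Published named facts (Gross–Zagier, Kolyvagin's finiteness and `p`-bound, Skinner 2016 Thm. C,
GZK, modularity ×2, Hoffstein–Luo, Mazur on the Manin constant), Shimura reciprocity at conductor 1 (`hrec`),
McCallum (`hMc`), Darmon Thm. 3.6 (`h36`), JSW17 Thm. 3.3.1-mult (`h331`) and `hZα` (Kolyvagin's conjecture mod
`p`, ∀-frame ♯ typing, ONLY on the (α) ∩ Locus pairs at Hoffstein–Luo fields; imc-p1 g5's binder verbatim) ⟹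
`P2OpenInputOnTreeAt W p` at every (ram) pair with no erratum datum and `p ∤ ∏_ℓ c_ℓ(E)`. Proof: reduce to the
crux's binders (`ClassX11b W p`, `5 ≤ p`, `Surj W p`); on `p ∤ ∏ c_ℓ` clause (iv) holds, so the REST‴ hypothesis
gives the (α) clause; then imc-p1 g5's `Koly.openInputOnTreeAt_of_kolyvaginFramesHLAt_of_five_le` with the control
identity from `h331`. CONDITIONAL (SZ14 Thm. 1.3 is a PREPRINT); nothing booked.
[cite: SkinnerZhang2014, Thm. 1.3 (arXiv:1407.1099 §1) (shape of `hZα`)] [cite: McCallumLMS1991, §5 Cor. 5.6 (p. 310)]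
[cite: Darmon2004, Thm. 3.6] [cite: JetchevSkinnerWan2017, Thm. 3.3.1 and §7.4.1]
[cite: SilvermanATAEC1994, Cor. IV.9.2(d) with (b) (PDF p. 340)] -/
theorem rest3Locus_of_kolyvaginSharpAlpha
    (hGZ : ∀ (N : ℕ) [NeZero N] (W : WeierstrassCurve ℚ) (K : Type) [Field K] [NumberField K],
      gross_zagier N W K)
    (hKo : ∀ (N : ℕ) [NeZero N] (W : WeierstrassCurve ℚ) (K : Type) [Field K] [NumberField K],
      kolyvagin N W K)
    (hB : ∀ (N : ℕ) [NeZero N] (W : WeierstrassCurve ℚ) (K : Type) [Field K] [NumberField K],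
      Kolyvagin1990_padicValNat_card_sha_le N W K)
    (hSk : Skinner2016.thmC_padicValRat_bsd_rank_zero)
    (hGZK : rank_eq_analyticRank_of_analyticRank_le_one) (hmod : hasEntireLFunction_rat)
    (hnf : exists_isNewformOf) (hHL : HoffsteinLuo1997_exists_twist_L_one_ne_zero)
    (hMaz : mazur_not_dvd_maninConstant_of_odd)
    (hrec : ∀ (N : ℕ) [NeZero N] (W : WeierstrassCurve ℚ) (K : Type) [Field K] [NumberField K],
      heegnerPointOfConductor_one_galoisConj N W K)
    (hMc : McCallum1991_pow_dvd_card_sha_primary_of_certificate)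
    (h36 : ∀ (N : ℕ) [NeZero N] (W : WeierstrassCurve ℚ) (K : Type) [Field K] [NumberField K],
      phi_heegnerTau_mem_range_map_singularModuliField N W K)
    (h331 : JetchevSkinnerWan2017.thm331_anticyclotomicControl_mult)
    (hZα : ∀ (W : WeierstrassCurve ℚ) [W.IsElliptic] [W.IsGloballyMinimal] [NeZero (W.conductorNorm ℤ)]
      (p : ℕ) [hp : Fact p.Prime] (K : Type) [Field K] [NumberField K]
      (Dt : ModularParametrizationData W (W.conductorNorm ℤ)) (β : ℤ) (ι : K →+* ℂ),
      ClassX11b W p → 5 ≤ p → W.HasMultiplicativeReductionAtPrime p → Rank1Residual.Surj W p →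
      Rank1Residual.Ram W p → ¬ p ∣ W.tamagawaProduct →
      (∀ (q : ℕ) [Fact q.Prime], q ≠ 2 → q ≠ p → Rank1Residual.Mult W q →
        ¬ W.HasSplitMultiplicativeReductionAtPrime q → p ∣ padicValInt q W.minimalDiscriminantInt) →
      IsImaginaryQuadratic K → Odd (NumberField.discr K) →
      SatisfiesHeegnerHypothesis (W.conductorNorm ℤ) K →
      (W.quadraticTwist (NumberField.discr K : ℚ)).entireLFunction 1 ≠ 0 →
      NumberField.discr K ≠ -3 →
      (4 * (W.conductorNorm ℤ : ℤ)) ∣ β ^ 2 - NumberField.discr K → ¬ (p : ℤ) ∣ Dt.c →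
      ∃ (n : ℕ) (d : KolyvaginHeegnerData Dt β ι n),
        KolyvaginDescent.KolSupp (Zhang2014.IsKolyvaginPrime (W.conductorNorm ℤ) W K p) n ∧
          d.kolyvaginClass hp.out 1 ≠ 0) :
    ∀ (W : WeierstrassCurve ℚ) [W.IsElliptic] [W.IsGloballyMinimal] (p : ℕ) [Fact p.Prime],
      Literature.NumberTheory.EllipticCurves.Rank1Residual.Ram W p →
      ¬ ((∃ (q : ℕ) (_ : Fact q.Prime), q ≠ 2 ∧ q ≠ p ∧ Literature.NumberTheory.EllipticCurves.Rank1Residual.Mult W q ∧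
          ¬ W.HasSplitMultiplicativeReductionAtPrime q ∧ ¬ p ∣ padicValInt q W.minimalDiscriminantInt) ∧
        (∀ P : (W.baseChange ℚ_[p]).toAffine.Point, p • P = 0 → P = 0)) →
      ¬ p ∣ W.tamagawaProduct →
      Summit.BirchSwinnertonDyer.Rank1Residual.X11b.P2OpenInputOnTreeAt W p := by
  intro W _ _ p hp hram hno htam
  refine p2OpenInputOnTreeAt_of_imp_surj W p fun hX hp5 hs ↦ ?_
  haveI : NeZero (W.conductorNorm ℤ) := ⟨(W.conductorNorm_pos_holds).ne'⟩
  have hmult : W.HasMultiplicativeReductionAtPrime p := hX.2.2.1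
  -- (iv) is automatic on `p ∤ ∏ c_ℓ`
  have hiv : ∀ Q : (W.baseChange ℚ_[p]).toAffine.Point, p • Q = 0 → Q = 0 :=
    LocalTorsion.localTorsion_eq_zero_of_not_dvd_tamagawaProduct W p (le_trans (by norm_num) hp5) hmult htam
  -- hence the REST‴ hypothesis is the (α) clause
  have hα : ∀ (q : ℕ) [Fact q.Prime], q ≠ 2 → q ≠ p → Rank1Residual.Mult W q →
      ¬ W.HasSplitMultiplicativeReductionAtPrime q → p ∣ padicValInt q W.minimalDiscriminantInt := by
    intro q _ hq2 hqp hmq hnsq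
    by_contra hv
    exact hno ⟨⟨q, inferInstance, hq2, hqp, hmq, hnsq, hv⟩, hiv⟩
  exact Three.Koly.openInputOnTreeAt_of_kolyvaginFramesHLAt_of_five_le hGZ hKo hB hSk hGZK hmod hnf hHL hMaz hrec
    hMc (kolyvaginRoadThree_hKD_of_darmon36 h36) W p hX hp5 hram htam (p2ControlOnTreeAt_of_thm331Mult W p h331 hKo)
    (fun K _ _ Dt β ι hK hodd hHN hLt h3 hβ hc ↦
      hZα W p K Dt β ι hX hp5 hmult hs hram htam hα hK hodd hHN hLt h3 hβ hc)

/-- **`stub_rest3_locus` BY THE ROUTE'S NAMES ⟸ `hZα`**: `PublishedInputsFive` (support item 19066) +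
`JSWAnticyclotomicControlMult` (19626) + Shimura reciprocity + McCallum + Darmon 3.6 + `hZα` ⟹ the registered
statement of `stub_rest3_locus` verbatim. CONDITIONAL; nothing booked.
[cite: SkinnerZhang2014, Thm. 1.3 (shape of `hZα`)] [cite: McCallumLMS1991, §5 Cor. 5.6 (p. 310)]
[cite: Darmon2004, Thm. 3.6] [cite: JetchevSkinnerWan2017, Thm. 3.3.1] -/
theorem rest3Locus_of_publishedInputsFive_of_kolyvaginSharpAlpha
    (hF : PublishedInputsFive) (h331 : JSWAnticyclotomicControlMult)
    (hrec : ∀ (N : ℕ) [NeZero N] (W : WeierstrassCurve ℚ) (K : Type) [Field K] [NumberField K],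
      heegnerPointOfConductor_one_galoisConj N W K)
    (hMc : McCallum1991_pow_dvd_card_sha_primary_of_certificate)
    (h36 : ∀ (N : ℕ) [NeZero N] (W : WeierstrassCurve ℚ) (K : Type) [Field K] [NumberField K],
      phi_heegnerTau_mem_range_map_singularModuliField N W K)
    (hZα : ∀ (W : WeierstrassCurve ℚ) [W.IsElliptic] [W.IsGloballyMinimal] [NeZero (W.conductorNorm ℤ)]
      (p : ℕ) [hp : Fact p.Prime] (K : Type) [Field K] [NumberField K]
      (Dt : ModularParametrizationData W (W.conductorNorm ℤ)) (β : ℤ) (ι : K →+* ℂ),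
      ClassX11b W p → 5 ≤ p → W.HasMultiplicativeReductionAtPrime p → Rank1Residual.Surj W p →
      Rank1Residual.Ram W p → ¬ p ∣ W.tamagawaProduct →
      (∀ (q : ℕ) [Fact q.Prime], q ≠ 2 → q ≠ p → Rank1Residual.Mult W q →
        ¬ W.HasSplitMultiplicativeReductionAtPrime q → p ∣ padicValInt q W.minimalDiscriminantInt) →
      IsImaginaryQuadratic K → Odd (NumberField.discr K) →
      SatisfiesHeegnerHypothesis (W.conductorNorm ℤ) K →
      (W.quadraticTwist (NumberField.discr K : ℚ)).entireLFunction 1 ≠ 0 →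
      NumberField.discr K ≠ -3 →
      (4 * (W.conductorNorm ℤ : ℤ)) ∣ β ^ 2 - NumberField.discr K → ¬ (p : ℤ) ∣ Dt.c →
      ∃ (n : ℕ) (d : KolyvaginHeegnerData Dt β ι n),
        KolyvaginDescent.KolSupp (Zhang2014.IsKolyvaginPrime (W.conductorNorm ℤ) W K p) n ∧
          d.kolyvaginClass hp.out 1 ≠ 0) :
    ∀ (W : WeierstrassCurve ℚ) [W.IsElliptic] [W.IsGloballyMinimal] (p : ℕ) [Fact p.Prime],
      Literature.NumberTheory.EllipticCurves.Rank1Residual.Ram W p →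
      ¬ ((∃ (q : ℕ) (_ : Fact q.Prime), q ≠ 2 ∧ q ≠ p ∧ Literature.NumberTheory.EllipticCurves.Rank1Residual.Mult W q ∧
          ¬ W.HasSplitMultiplicativeReductionAtPrime q ∧ ¬ p ∣ padicValInt q W.minimalDiscriminantInt) ∧
        (∀ P : (W.baseChange ℚ_[p]).toAffine.Point, p • P = 0 → P = 0)) →
      ¬ p ∣ W.tamagawaProduct →
      Summit.BirchSwinnertonDyer.Rank1Residual.X11b.P2OpenInputOnTreeAt W p := by
  obtain ⟨hGZ, hKo, hB, hSk, -, hGZK, hmod, hnf, hHL, -, hMaz, -, -, -, -⟩ := hF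
  exact rest3Locus_of_kolyvaginSharpAlpha hGZ hKo hB hSk hGZK hmod hnf hHL hMaz hrec hMc h36 h331 hZα

/-- **`stub_rest3_locus` BY THE ROUTE'S NAMES ⟸ the Locus-wide Kolyvagin hypothesis `hZ₅`** (KOLY's crux shape
at `p ≥ 5`, asked at every Locus pair — stronger than `hZα`): immediate from imc-p1 g5's
`openInputOnTree_onLocus_of_publishedInputsFive_of_kolyvaginFramesHL` through the crux's own binders. CONDITIONAL;
nothing booked. [cite: SkinnerZhang2014, Thm. 1.3 (shape of `hZ₅`)] [cite: McCallumLMS1991, §5 Cor. 5.6 (p. 310)]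
[cite: Darmon2004, Thm. 3.6] [cite: JetchevSkinnerWan2017, Thm. 3.3.1] -/
theorem rest3Locus_of_publishedInputsFive_of_kolyvaginFramesHL
    (hF : PublishedInputsFive) (h331 : JSWAnticyclotomicControlMult)
    (hrec : ∀ (N : ℕ) [NeZero N] (W : WeierstrassCurve ℚ) (K : Type) [Field K] [NumberField K],
      heegnerPointOfConductor_one_galoisConj N W K)
    (hMc : McCallum1991_pow_dvd_card_sha_primary_of_certificate)
    (h36 : ∀ (N : ℕ) [NeZero N] (W : WeierstrassCurve ℚ) (K : Type) [Field K] [NumberField K],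
      phi_heegnerTau_mem_range_map_singularModuliField N W K)
    (hZ₅ : ∀ (W : WeierstrassCurve ℚ) [W.IsElliptic] [W.IsGloballyMinimal] [NeZero (W.conductorNorm ℤ)]
      (p : ℕ) [hp : Fact p.Prime] (K : Type) [Field K] [NumberField K]
      (Dt : ModularParametrizationData W (W.conductorNorm ℤ)) (β : ℤ) (ι : K →+* ℂ),
      ClassX11b W p → 5 ≤ p → W.HasMultiplicativeReductionAtPrime p → Rank1Residual.Surj W p →
      Rank1Residual.Ram W p → ¬ p ∣ W.tamagawaProduct →
      IsImaginaryQuadratic K → Odd (NumberField.discr K) →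
      SatisfiesHeegnerHypothesis (W.conductorNorm ℤ) K →
      (W.quadraticTwist (NumberField.discr K : ℚ)).entireLFunction 1 ≠ 0 →
      NumberField.discr K ≠ -3 →
      (4 * (W.conductorNorm ℤ : ℤ)) ∣ β ^ 2 - NumberField.discr K → ¬ (p : ℤ) ∣ Dt.c →
      ∃ (n : ℕ) (d : KolyvaginHeegnerData Dt β ι n),
        KolyvaginDescent.KolSupp (Zhang2014.IsKolyvaginPrime (W.conductorNorm ℤ) W K p) n ∧
          d.kolyvaginClass hp.out 1 ≠ 0) :
    ∀ (W : WeierstrassCurve ℚ) [W.IsElliptic] [W.IsGloballyMinimal] (p : ℕ) [Fact p.Prime],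
      Literature.NumberTheory.EllipticCurves.Rank1Residual.Ram W p →
      ¬ ((∃ (q : ℕ) (_ : Fact q.Prime), q ≠ 2 ∧ q ≠ p ∧ Literature.NumberTheory.EllipticCurves.Rank1Residual.Mult W q ∧
          ¬ W.HasSplitMultiplicativeReductionAtPrime q ∧ ¬ p ∣ padicValInt q W.minimalDiscriminantInt) ∧
        (∀ P : (W.baseChange ℚ_[p]).toAffine.Point, p • P = 0 → P = 0)) →
      ¬ p ∣ W.tamagawaProduct →
      Summit.BirchSwinnertonDyer.Rank1Residual.X11b.P2OpenInputOnTreeAt W p :=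
  fun W _ _ p _ hram _ htam ↦ p2OpenInputOnTreeAt_of_imp_surj W p fun hX hp5 _ ↦
    openInputOnTree_onLocus_of_publishedInputsFive_of_kolyvaginFramesHL hF h331 hrec hMc h36 hZ₅ W p hX hp5 hram
      htam

/-! ## §2 The two cuts of REST‴ nest (bookkeeping; nothing asserted) -/

/-- **`stub_rest3_locus` is a restriction of the crux** (drop `p ∤ ∏ c_ℓ`; nothing is lost on the Locus side of
the registered split). [folklore] -/
theorem rest3Locus_of_ramNoErratumDataAtFive (h : RamNoErratumDataAtFive) :
    ∀ (W : WeierstrassCurve ℚ) [W.IsElliptic] [W.IsGloballyMinimal] (p : ℕ) [Fact p.Prime],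
      Literature.NumberTheory.EllipticCurves.Rank1Residual.Ram W p →
      ¬ ((∃ (q : ℕ) (_ : Fact q.Prime), q ≠ 2 ∧ q ≠ p ∧ Literature.NumberTheory.EllipticCurves.Rank1Residual.Mult W q ∧
          ¬ W.HasSplitMultiplicativeReductionAtPrime q ∧ ¬ p ∣ padicValInt q W.minimalDiscriminantInt) ∧
        (∀ P : (W.baseChange ℚ_[p]).toAffine.Point, p • P = 0 → P = 0)) →
      ¬ p ∣ W.tamagawaProduct →
      Summit.BirchSwinnertonDyer.Rank1Residual.X11b.P2OpenInputOnTreeAt W p :=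
  fun W _ _ p _ hram hno _ ↦ h W p hram hno

/-- **Locus ⊆ (NW): `stub_rest3_locus` ⟸ `Rest3NoWitnessBranchAtFive`.** At the crux's binders (`ClassX11b W p`,
`5 ≤ p`) a pair with `p ∤ ∏ c_ℓ` is torsion-free at `p` (`LocalTorsion.localTorsion_eq_zero_of_not_dvd_tamagawaProduct`),
so the REST‴ hypothesis there is exactly the no-witness clause of branch (NW). Bookkeeping only.
[cite: SilvermanATAEC1994, Cor. IV.9.2(d) with (b) (PDF p. 340)] -/
theorem rest3Locus_of_rest3NoWitnessBranchAtFive (hN : Rest3NoWitnessBranchAtFive) :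
    ∀ (W : WeierstrassCurve ℚ) [W.IsElliptic] [W.IsGloballyMinimal] (p : ℕ) [Fact p.Prime],
      Literature.NumberTheory.EllipticCurves.Rank1Residual.Ram W p →
      ¬ ((∃ (q : ℕ) (_ : Fact q.Prime), q ≠ 2 ∧ q ≠ p ∧ Literature.NumberTheory.EllipticCurves.Rank1Residual.Mult W q ∧
          ¬ W.HasSplitMultiplicativeReductionAtPrime q ∧ ¬ p ∣ padicValInt q W.minimalDiscriminantInt) ∧
        (∀ P : (W.baseChange ℚ_[p]).toAffine.Point, p • P = 0 → P = 0)) →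
      ¬ p ∣ W.tamagawaProduct →
      Summit.BirchSwinnertonDyer.Rank1Residual.X11b.P2OpenInputOnTreeAt W p := by
  intro W _ _ p _ hram hno htam
  refine p2OpenInputOnTreeAt_of_imp_surj W p fun hX hp5 _ ↦ ?_
  have hiv : ∀ Q : (W.baseChange ℚ_[p]).toAffine.Point, p • Q = 0 → Q = 0 :=
    LocalTorsion.localTorsion_eq_zero_of_not_dvd_tamagawaProduct W p (le_trans (by norm_num) hp5) hX.2.2.1 htam
  exact hN W p hram hiv fun hq ↦ hno ⟨hq, hiv⟩

/-- **(T) ⊆ Tam: `Rest3TorsionBranchAtFive` ⟸ `stub_rest3_tam`.** At the crux's binders a non-zero `p`-torsion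
point of `E(ℚ_p)` forces `p ∣ ∏ c_ℓ` (imc-p1's `Koly.dvd_tamagawaProduct_of_not_localTorsionFree`), and it refutes
the torsion conjunct of REST‴'s hypothesis; so REST⁗ restricted to (T)'s rows is (T). Bookkeeping only.
[cite: SilvermanATAEC1994, Cor. IV.9.2(d) with (b) (PDF p. 340)] -/
theorem rest3TorsionBranchAtFive_of_rest3Tam
    (hT : ∀ (W : WeierstrassCurve ℚ) [W.IsElliptic] [W.IsGloballyMinimal] (p : ℕ) [Fact p.Prime],
      Literature.NumberTheory.EllipticCurves.Rank1Residual.Ram W p →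
      ¬ ((∃ (q : ℕ) (_ : Fact q.Prime), q ≠ 2 ∧ q ≠ p ∧ Literature.NumberTheory.EllipticCurves.Rank1Residual.Mult W q ∧
          ¬ W.HasSplitMultiplicativeReductionAtPrime q ∧ ¬ p ∣ padicValInt q W.minimalDiscriminantInt) ∧
        (∀ P : (W.baseChange ℚ_[p]).toAffine.Point, p • P = 0 → P = 0)) →
      p ∣ W.tamagawaProduct →
      Summit.BirchSwinnertonDyer.Rank1Residual.X11b.P2OpenInputOnTreeAt W p) :
    Rest3TorsionBranchAtFive := by
  intro W _ _ p _ hram hP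
  refine p2OpenInputOnTreeAt_of_imp_surj W p fun hX hp5 _ ↦ ?_
  obtain ⟨P, hP0, hne⟩ := hP
  have hnt : ¬ ∀ Q : (W.baseChange ℚ_[p]).toAffine.Point, p • Q = 0 → Q = 0 := fun h ↦ hne (h P hP0)
  exact hT W p hram (fun h ↦ hnt h.2)
    (Three.Koly.dvd_tamagawaProduct_of_not_localTorsionFree W p (le_trans (by norm_num) hp5) hX.2.2.1 hnt)

/-- **Tam ⟸ (T) + (NW): `stub_rest3_tam` from the two torsion branches** (REST⁗ is a restriction of REST‴ =
(T) ∧ (NW), `rest3_of_branches`). Bookkeeping only. [folklore] -/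
theorem rest3Tam_of_branches (hT : Rest3TorsionBranchAtFive) (hN : Rest3NoWitnessBranchAtFive) :
    ∀ (W : WeierstrassCurve ℚ) [W.IsElliptic] [W.IsGloballyMinimal] (p : ℕ) [Fact p.Prime],
      Literature.NumberTheory.EllipticCurves.Rank1Residual.Ram W p →
      ¬ ((∃ (q : ℕ) (_ : Fact q.Prime), q ≠ 2 ∧ q ≠ p ∧ Literature.NumberTheory.EllipticCurves.Rank1Residual.Mult W q ∧
          ¬ W.HasSplitMultiplicativeReductionAtPrime q ∧ ¬ p ∣ padicValInt q W.minimalDiscriminantInt) ∧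
        (∀ P : (W.baseChange ℚ_[p]).toAffine.Point, p • P = 0 → P = 0)) →
      p ∣ W.tamagawaProduct →
      Summit.BirchSwinnertonDyer.Rank1Residual.X11b.P2OpenInputOnTreeAt W p :=
  fun W _ _ p _ hram hno _ ↦ rest3_of_branches hT hN W p hram hno

/-- **The crux BY NAME from the registered Locus stub's Kolyvagin derivation and the torsion branches restricted to
`p ∣ ∏ c_ℓ`**: `PublishedInputsFive` → `JSWAnticyclotomicControlMult` → `hrec` → `hMc` → `h36` → `hZα` → (T) → (NW) →
`RamNoErratumDataAtFive` — i.e. modulo `hZα` (PRE-covered) the crux's unreached content is (T) ∪ ((NW) ∩ Tam)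
(class-wide 3 687 + 18 793 = 22 480 pairs = REST⁗). Composition of §1 with imc-p1 g5's glue
`ramNoErratumDataAtFive_of_kolyvaginFramesHLAlpha_of_restTam`. CONDITIONAL; nothing booked.
[cite: SkinnerZhang2014, Thm. 1.3 (shape of `hZα`)] [cite: McCallumLMS1991, §5 Cor. 5.6 (p. 310)]
[cite: Darmon2004, Thm. 3.6] [cite: JetchevSkinnerWan2017, Thm. 3.3.1] -/
theorem ramNoErratumDataAtFive_of_kolyvaginSharpAlpha_of_branches
    (hF : PublishedInputsFive) (h331 : JSWAnticyclotomicControlMult)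
    (hrec : ∀ (N : ℕ) [NeZero N] (W : WeierstrassCurve ℚ) (K : Type) [Field K] [NumberField K],
      heegnerPointOfConductor_one_galoisConj N W K)
    (hMc : McCallum1991_pow_dvd_card_sha_primary_of_certificate)
    (h36 : ∀ (N : ℕ) [NeZero N] (W : WeierstrassCurve ℚ) (K : Type) [Field K] [NumberField K],
      phi_heegnerTau_mem_range_map_singularModuliField N W K)
    (hZα : ∀ (W : WeierstrassCurve ℚ) [W.IsElliptic] [W.IsGloballyMinimal] [NeZero (W.conductorNorm ℤ)]
      (p : ℕ) [hp : Fact p.Prime] (K : Type) [Field K] [NumberField K]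
      (Dt : ModularParametrizationData W (W.conductorNorm ℤ)) (β : ℤ) (ι : K →+* ℂ),
      ClassX11b W p → 5 ≤ p → W.HasMultiplicativeReductionAtPrime p → Rank1Residual.Surj W p →
      Rank1Residual.Ram W p → ¬ p ∣ W.tamagawaProduct →
      (∀ (q : ℕ) [Fact q.Prime], q ≠ 2 → q ≠ p → Rank1Residual.Mult W q →
        ¬ W.HasSplitMultiplicativeReductionAtPrime q → p ∣ padicValInt q W.minimalDiscriminantInt) →
      IsImaginaryQuadratic K → Odd (NumberField.discr K) →
      SatisfiesHeegnerHypothesis (W.conductorNorm ℤ) K →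
      (W.quadraticTwist (NumberField.discr K : ℚ)).entireLFunction 1 ≠ 0 →
      NumberField.discr K ≠ -3 →
      (4 * (W.conductorNorm ℤ : ℤ)) ∣ β ^ 2 - NumberField.discr K → ¬ (p : ℤ) ∣ Dt.c →
      ∃ (n : ℕ) (d : KolyvaginHeegnerData Dt β ι n),
        KolyvaginDescent.KolSupp (Zhang2014.IsKolyvaginPrime (W.conductorNorm ℤ) W K p) n ∧
          d.kolyvaginClass hp.out 1 ≠ 0)
    (hT : Rest3TorsionBranchAtFive)
    (hNtam : ∀ (W : WeierstrassCurve ℚ) [W.IsElliptic] [W.IsGloballyMinimal] (p : ℕ) [Fact p.Prime],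
      Literature.NumberTheory.EllipticCurves.Rank1Residual.Ram W p →
      (∀ P : (W.baseChange ℚ_[p]).toAffine.Point, p • P = 0 → P = 0) →
      ¬ (∃ (q : ℕ) (_ : Fact q.Prime), q ≠ 2 ∧ q ≠ p ∧ Literature.NumberTheory.EllipticCurves.Rank1Residual.Mult W q ∧
          ¬ W.HasSplitMultiplicativeReductionAtPrime q ∧ ¬ p ∣ padicValInt q W.minimalDiscriminantInt) →
      p ∣ W.tamagawaProduct →
      Summit.BirchSwinnertonDyer.Rank1Residual.X11b.P2OpenInputOnTreeAt W p) :
    RamNoErratumDataAtFive := by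
  refine ramNoErratumDataAtFive_of_kolyvaginFramesHLAlpha_of_restTam hF h331 hrec hMc h36 hZα ?_
  intro W _ _ p _ hram hno htam
  by_cases htors : ∀ P : (W.baseChange ℚ_[p]).toAffine.Point, p • P = 0 → P = 0
  · exact hNtam W p hram htors (fun hq ↦ hno ⟨hq, htors⟩) htam
  · push Not at htors
    exact hT W p hram htors

end Summit.BirchSwinnertonDyer.BirchSwinnertonDyer.Theorems

end
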